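import Literature.Algebra.Polynomial.CasasAlvero.Degree8CharP
import Literature.Algebra.Polynomial.CasasAlvero.Degree9CharP
import HarnessLib

/-!
# Bad prime 23: `CA_8` and `CA_9` fail in characteristic 23

Explicit prime-field-rational Casas-Alvero polynomials in the depressed normal forms `nf8`, `nf9` of this directory, found by random
sampling of the normal form over `F_23` (`dgen/rsearch.py` of the seat-2 g4 packet; a hit = an `f` whose Hasse derivatives
`H_1 f, …, H_{d-1} f` each vanish at an `F_23`-rational root of `f`): `(p, d) = (23, 8)` (14 hits in 3.9·10^6 samples), `(23, 9)` (2 hits in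
3.7·10^6).  Each refutes `CA_d` over EVERY field of characteristic `23`; with `Degree8CharP*.lean`, `Degree9CharP*.lean`, `MoreBadPrimes.lean`
the kernel-checked bad primes beyond the degree-`≤ 7` tables of [CastryckLaterveerOunaies2012, §2] are `d = 8: 13, 17, 19, 23`,
`d = 9: 11, 13, 17, 19, 23`, `d = 10: 13, 19`, `d = 11: 13`.  [folklore]
-/

noncomputable section

open Polynomial

namespace Literature.Algebra.Polynomial.CasasAlvero

variable (K : Type*) [Field K]

section Char23
variable [CharP K 23]

/-- `X^8 + (-9) X^4 + (10) X^3 + (-7) X^1` is Casas-Alvero in characteristic 23 (witness roots H1↦-9, H2↦0, H3↦-7, H4↦7, H5↦0, H6↦0, H7↦0). [folklore] -/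
theorem isCasasAlvero_nf8_char_23 : IsCasasAlvero (nf8 K (0) (0) (-9) (10) (0) (-7)) := by
  have hp : (23 : K) = 0 := by simpa using CharP.cast_eq_zero K 23
  intro i hi0 hi
  rw [natDegree_nf8] at hi
  unfold nf8
  interval_cases i
  · refine ⟨(-9 : K), ?_, ?_⟩
    · simp only [eval_add, eval_pow, eval_X, eval_smul, smul_eq_mul]
      linear_combination (1868715 : K) * hp
    · simp only [map_add, map_smul, hasseDeriv_X_pow, eval_add, eval_mul, eval_C, eval_pow, eval_X, eval_smul, smul_eq_mul,
        show Nat.choose 8 1 = 8 from rfl, show Nat.choose 6 1 = 6 from rfl, show Nat.choose 5 1 = 5 from rfl, show Nat.choose 4 1 = 4 from rfl, show Nat.choose 3 1 = 3 from rfl, show Nat.choose 2 1 = 2 from rfl, show Nat.choose 1 1 = 1 from rfl]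
      push_cast
      linear_combination (-1662395 : K) * hp
  · refine ⟨(0 : K), ?_, ?_⟩
    · simp only [eval_add, eval_pow, eval_X, eval_smul, smul_eq_mul]
      linear_combination (0 : K) * hp
    · simp only [map_add, map_smul, hasseDeriv_X_pow, eval_add, eval_mul, eval_C, eval_pow, eval_X, eval_smul, smul_eq_mul,
        show Nat.choose 8 2 = 28 from rfl, show Nat.choose 6 2 = 15 from rfl, show Nat.choose 5 2 = 10 from rfl, show Nat.choose 4 2 = 6 from rfl, show Nat.choose 3 2 = 3 from rfl, show Nat.choose 2 2 = 1 from rfl, show Nat.choose 1 2 = 0 from rfl]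
      push_cast
      linear_combination (0 : K) * hp
  · refine ⟨(-7 : K), ?_, ?_⟩
    · simp only [eval_add, eval_pow, eval_X, eval_smul, smul_eq_mul]
      linear_combination (249557 : K) * hp
    · simp only [map_add, map_smul, hasseDeriv_X_pow, eval_add, eval_mul, eval_C, eval_pow, eval_X, eval_smul, smul_eq_mul,
        show Nat.choose 8 3 = 56 from rfl, show Nat.choose 6 3 = 20 from rfl, show Nat.choose 5 3 = 10 from rfl, show Nat.choose 4 3 = 4 from rfl, show Nat.choose 3 3 = 1 from rfl, show Nat.choose 2 3 = 0 from rfl, show Nat.choose 1 3 = 0 from rfl]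
      push_cast
      linear_combination (-40910 : K) * hp
  · refine ⟨(7 : K), ?_, ?_⟩
    · simp only [eval_add, eval_pow, eval_X, eval_smul, smul_eq_mul]
      linear_combination (249851 : K) * hp
    · simp only [map_add, map_smul, hasseDeriv_X_pow, eval_add, eval_mul, eval_C, eval_pow, eval_X, eval_smul, smul_eq_mul,
        show Nat.choose 8 4 = 70 from rfl, show Nat.choose 6 4 = 15 from rfl, show Nat.choose 5 4 = 5 from rfl, show Nat.choose 4 4 = 1 from rfl, show Nat.choose 3 4 = 0 from rfl, show Nat.choose 2 4 = 0 from rfl, show Nat.choose 1 4 = 0 from rfl]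
      push_cast
      linear_combination (7307 : K) * hp
  · refine ⟨(0 : K), ?_, ?_⟩
    · simp only [eval_add, eval_pow, eval_X, eval_smul, smul_eq_mul]
      linear_combination (0 : K) * hp
    · simp only [map_add, map_smul, hasseDeriv_X_pow, eval_add, eval_mul, eval_C, eval_pow, eval_X, eval_smul, smul_eq_mul,
        show Nat.choose 8 5 = 56 from rfl, show Nat.choose 6 5 = 6 from rfl, show Nat.choose 5 5 = 1 from rfl, show Nat.choose 4 5 = 0 from rfl, show Nat.choose 3 5 = 0 from rfl, show Nat.choose 2 5 = 0 from rfl, show Nat.choose 1 5 = 0 from rfl]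
      push_cast
      linear_combination (0 : K) * hp
  · refine ⟨(0 : K), ?_, ?_⟩
    · simp only [eval_add, eval_pow, eval_X, eval_smul, smul_eq_mul]
      linear_combination (0 : K) * hp
    · simp only [map_add, map_smul, hasseDeriv_X_pow, eval_add, eval_mul, eval_C, eval_pow, eval_X, eval_smul, smul_eq_mul,
        show Nat.choose 8 6 = 28 from rfl, show Nat.choose 6 6 = 1 from rfl, show Nat.choose 5 6 = 0 from rfl, show Nat.choose 4 6 = 0 from rfl, show Nat.choose 3 6 = 0 from rfl, show Nat.choose 2 6 = 0 from rfl, show Nat.choose 1 6 = 0 from rfl]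
      push_cast
      linear_combination (0 : K) * hp
  · refine ⟨(0 : K), ?_, ?_⟩
    · simp only [eval_add, eval_pow, eval_X, eval_smul, smul_eq_mul]
      linear_combination (0 : K) * hp
    · simp only [map_add, map_smul, hasseDeriv_X_pow, eval_add, eval_mul, eval_C, eval_pow, eval_X, eval_smul, smul_eq_mul,
        show Nat.choose 8 7 = 8 from rfl, show Nat.choose 6 7 = 0 from rfl, show Nat.choose 5 7 = 0 from rfl, show Nat.choose 4 7 = 0 from rfl, show Nat.choose 3 7 = 0 from rfl, show Nat.choose 2 7 = 0 from rfl, show Nat.choose 1 7 = 0 from rfl]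
      push_cast
      linear_combination (0 : K) * hp

end Char23

/-- `CA_8` FAILS over every field of characteristic `23`. [folklore] -/
theorem not_holdsInDegree_eight_of_char_23 [CharP K 23] : ¬ HoldsInDegree K 8 := by
  have hq : (23 : K) = 0 := by simpa using CharP.cast_eq_zero K 23
  exact not_holdsInDegree_eight_of_nf8 K (isCasasAlvero_nf8_char_23 K)
    (fun h => one_ne_zero (by linear_combination (-4 : K) * h - (1 : K) * hq : (1 : K) = 0))

section Char23Deg9
variable [CharP K 23]

/-- `X^9 + (-7) X^5 + (11) X^4 + (9) X^2` is Casas-Alvero in characteristic 23 (witness roots H1↦0, H2↦6, H3↦0, H4↦-7, H5↦-7, H6↦0, H7↦0, H8↦0). [folklore] -/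
theorem isCasasAlvero_nf9_char_23 : IsCasasAlvero (nf9 K (0) (0) (-7) (11) (0) (9) (0)) := by
  have hp : (23 : K) = 0 := by simpa using CharP.cast_eq_zero K 23
  intro i hi0 hi
  rw [natDegree_nf9] at hi
  unfold nf9
  interval_cases i
  · refine ⟨(0 : K), ?_, ?_⟩
    · simp only [eval_add, eval_pow, eval_X, eval_smul, smul_eq_mul]
      linear_combination (0 : K) * hp
    · simp only [map_add, map_smul, hasseDeriv_X_pow, eval_add, eval_mul, eval_C, eval_pow, eval_X, eval_smul, smul_eq_mul,
        show Nat.choose 9 1 = 9 from rfl, show Nat.choose 7 1 = 7 from rfl, show Nat.choose 6 1 = 6 from rfl, show Nat.choose 5 1 = 5 from rfl, show Nat.choose 4 1 = 4 from rfl, show Nat.choose 3 1 = 3 from rfl, show Nat.choose 2 1 = 2 from rfl, show Nat.choose 1 1 = 1 from rfl]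
      push_cast
      linear_combination (0 : K) * hp
  · refine ⟨(6 : K), ?_, ?_⟩
    · simp only [eval_add, eval_pow, eval_X, eval_smul, smul_eq_mul]
      linear_combination (436428 : K) * hp
    · simp only [map_add, map_smul, hasseDeriv_X_pow, eval_add, eval_mul, eval_C, eval_pow, eval_X, eval_smul, smul_eq_mul,
        show Nat.choose 9 2 = 36 from rfl, show Nat.choose 7 2 = 21 from rfl, show Nat.choose 6 2 = 15 from rfl, show Nat.choose 5 2 = 10 from rfl, show Nat.choose 4 2 = 6 from rfl, show Nat.choose 3 2 = 3 from rfl, show Nat.choose 2 2 = 1 from rfl, show Nat.choose 1 2 = 0 from rfl]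
      push_cast
      linear_combination (437607 : K) * hp
  · refine ⟨(0 : K), ?_, ?_⟩
    · simp only [eval_add, eval_pow, eval_X, eval_smul, smul_eq_mul]
      linear_combination (0 : K) * hp
    · simp only [map_add, map_smul, hasseDeriv_X_pow, eval_add, eval_mul, eval_C, eval_pow, eval_X, eval_smul, smul_eq_mul,
        show Nat.choose 9 3 = 84 from rfl, show Nat.choose 7 3 = 35 from rfl, show Nat.choose 6 3 = 20 from rfl, show Nat.choose 5 3 = 10 from rfl, show Nat.choose 4 3 = 4 from rfl, show Nat.choose 3 3 = 1 from rfl, show Nat.choose 2 3 = 0 from rfl, show Nat.choose 1 3 = 0 from rfl]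
      push_cast
      linear_combination (0 : K) * hp
  · refine ⟨(-7 : K), ?_, ?_⟩
    · simp only [eval_add, eval_pow, eval_X, eval_smul, smul_eq_mul]
      linear_combination (-1748222 : K) * hp
    · simp only [map_add, map_smul, hasseDeriv_X_pow, eval_add, eval_mul, eval_C, eval_pow, eval_X, eval_smul, smul_eq_mul,
        show Nat.choose 9 4 = 126 from rfl, show Nat.choose 7 4 = 35 from rfl, show Nat.choose 6 4 = 15 from rfl, show Nat.choose 5 4 = 5 from rfl, show Nat.choose 4 4 = 1 from rfl, show Nat.choose 3 4 = 0 from rfl, show Nat.choose 2 4 = 0 from rfl, show Nat.choose 1 4 = 0 from rfl]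
      push_cast
      linear_combination (-92062 : K) * hp
  · refine ⟨(-7 : K), ?_, ?_⟩
    · simp only [eval_add, eval_pow, eval_X, eval_smul, smul_eq_mul]
      linear_combination (-1748222 : K) * hp
    · simp only [map_add, map_smul, hasseDeriv_X_pow, eval_add, eval_mul, eval_C, eval_pow, eval_X, eval_smul, smul_eq_mul,
        show Nat.choose 9 5 = 126 from rfl, show Nat.choose 7 5 = 21 from rfl, show Nat.choose 6 5 = 6 from rfl, show Nat.choose 5 5 = 1 from rfl, show Nat.choose 4 5 = 0 from rfl, show Nat.choose 3 5 = 0 from rfl, show Nat.choose 2 5 = 0 from rfl, show Nat.choose 1 5 = 0 from rfl]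
      push_cast
      linear_combination (13153 : K) * hp
  · refine ⟨(0 : K), ?_, ?_⟩
    · simp only [eval_add, eval_pow, eval_X, eval_smul, smul_eq_mul]
      linear_combination (0 : K) * hp
    · simp only [map_add, map_smul, hasseDeriv_X_pow, eval_add, eval_mul, eval_C, eval_pow, eval_X, eval_smul, smul_eq_mul,
        show Nat.choose 9 6 = 84 from rfl, show Nat.choose 7 6 = 7 from rfl, show Nat.choose 6 6 = 1 from rfl, show Nat.choose 5 6 = 0 from rfl, show Nat.choose 4 6 = 0 from rfl, show Nat.choose 3 6 = 0 from rfl, show Nat.choose 2 6 = 0 from rfl, show Nat.choose 1 6 = 0 from rfl]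
      push_cast
      linear_combination (0 : K) * hp
  · refine ⟨(0 : K), ?_, ?_⟩
    · simp only [eval_add, eval_pow, eval_X, eval_smul, smul_eq_mul]
      linear_combination (0 : K) * hp
    · simp only [map_add, map_smul, hasseDeriv_X_pow, eval_add, eval_mul, eval_C, eval_pow, eval_X, eval_smul, smul_eq_mul,
        show Nat.choose 9 7 = 36 from rfl, show Nat.choose 7 7 = 1 from rfl, show Nat.choose 6 7 = 0 from rfl, show Nat.choose 5 7 = 0 from rfl, show Nat.choose 4 7 = 0 from rfl, show Nat.choose 3 7 = 0 from rfl, show Nat.choose 2 7 = 0 from rfl, show Nat.choose 1 7 = 0 from rfl]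
      push_cast
      linear_combination (0 : K) * hp
  · refine ⟨(0 : K), ?_, ?_⟩
    · simp only [eval_add, eval_pow, eval_X, eval_smul, smul_eq_mul]
      linear_combination (0 : K) * hp
    · simp only [map_add, map_smul, hasseDeriv_X_pow, eval_add, eval_mul, eval_C, eval_pow, eval_X, eval_smul, smul_eq_mul,
        show Nat.choose 9 8 = 9 from rfl, show Nat.choose 7 8 = 0 from rfl, show Nat.choose 6 8 = 0 from rfl, show Nat.choose 5 8 = 0 from rfl, show Nat.choose 4 8 = 0 from rfl, show Nat.choose 3 8 = 0 from rfl, show Nat.choose 2 8 = 0 from rfl, show Nat.choose 1 8 = 0 from rfl]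
      push_cast
      linear_combination (0 : K) * hp

end Char23Deg9

/-- `CA_9` FAILS over every field of characteristic `23`. [folklore] -/
theorem not_holdsInDegree_nine_of_char_23 [CharP K 23] : ¬ HoldsInDegree K 9 := by
  have hq : (23 : K) = 0 := by simpa using CharP.cast_eq_zero K 23
  exact not_holdsInDegree_nine_of_nf9 K (isCasasAlvero_nf9_char_23 K)
    (fun h => one_ne_zero (by linear_combination (-7 : K) * h - (-4 : K) * hq : (1 : K) = 0))

end Literature.Algebra.Polynomial.CasasAlvero
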